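import Summits.Ventures.LatticeQCDFlow.Scaling.ReplicaExchangeFlowSwap
import Summits.Ventures.LatticeQCDFlow.Scaling.ReplicaExchangeDiffusive

/-!
HONEST FRAMING: exact (Metropolis-corrected) sampling algorithms for lattice gauge theory; figures
of merit are autocorrelation/cost numbers at stated couplings and volumes; no continuum-physics
claim.

# ReplicaExchangeFlowSwapDiffusive — SECTOR-PRESERVING FLOW SWAPS DO NOT BEAT DIFFUSION: FOR BIJECTIONS `φ_j` WITH
# `φ_j(A) = A` THE FLOW-ASSISTED SAMPLER OBEYS THE SAME PROFILE CEILING AS THE PLAIN ONE, AND WITH SECTOR-FROZEN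
# COLD REPLICAS `Gap(ptFlowSampler t μ M φ) ≤ 3td/(v·K(K+1)(2K+1))` — PERFECT MAPS BUY ACCEPTANCE, NOT ORDER
# (lean-2 GEN-19, ours)

Venture-side (OURS).  Cell `lqcd-flow` (pub-lqcd), unit `pub-lqcd-lean-2-g19`, 2026-08-25.  Chapter R: the profile
test functions of `Scaling/ReplicaExchangeDiffusive` (R10) applied to the flow-assisted sampler of
`Scaling/ReplicaExchangeFlowSwap` (`ptFlowSampler t μ M φ`: the pair `(x_j, x_{j+1})` is proposed as
`(φ_j⁻¹x_{j+1}, φ_jx_j)` and Metropolis-corrected).  The one hypothesis on the maps is that they PRESERVE THE SECTOR: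
`φ_j u ∈ A ↔ u ∈ A` — the situation of a flow between neighbouring couplings (or boundary conditions) that cannot
itself change the topological sector.  Then a flow swap changes the profile count `G_a(x) = Σ_k a_k f_A^{(μ_k)}(x_k)`
by exactly what a plain swap does, `(a_j − a_{j+1})(1_{Aᶜ}(x_j) − 1_{Aᶜ}(x_{j+1}))`, and every ceiling of R10
follows with the same constants, WHATEVER the maps (even perfect transports `φ_j♯μ_j = μ_{j+1}`, acceptance one).

## What is proved

* §1 `mem_symm_iff` ; **`flowProfileCount_sub_swap`** — the swap difference formula for sector-preserving maps;
  **`ptFlow_dirichletForm_swap_le`** (ANY observable: `𝓔_{FSw}(F) ≤ (2K)⁻¹Σ_jΣ_x π̃(x)(F(x) − F(x^{(j)}))²`);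
  **`ptFlow_dirichletForm_swap_profileCount_le`** (`≤ (2K)⁻¹Σ_j (a_j − a_{j+1})²D_j(A)`); `ptFlow_dirichletForm_split`.
* §2 **`ptFlow_spectralGap_le_profile`** — the profile ceiling
  `Gap ≤ [t/(2K)·Σ_j (a_j − a_{j+1})²D_j(A) + (1−t)/(K+1)·Σ_k a_k²Q_k(A,Aᶜ)]/Σ_k a_k²μ_k(A)μ_k(Aᶜ)`;
  **`ptFlowLinear_spectralGap_le`**; **`ptFlowFrozenSector_spectralGap_le`** — sector-frozen cold replicas
  (`Q_k(A,Aᶜ) = 0`, `k ≥ 1`), `D_j(A) ≤ d`, `μ_k(A)μ_k(Aᶜ) ≥ v > 0` (`k ≥ 1`) ⇒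
  `Gap(ptFlowSampler t μ M φ) ≤ 3td/(v·K(K+1)(2K+1))` for EVERY family of sector-preserving bijections `φ`.

Reading (no numerics implied): a learned map between ADJACENT replicas can raise the swap acceptance to one, but as
long as it maps each topological sector to itself the sector content still travels one level per accepted swap and
the relaxation time stays `≥ v·K(K+1)(2K+1)/(3td)` sampler steps — cubic in the number of replicas; only FEWER levels
(maps bridging distant couplings) or maps that MOVE mass between sectors change the law.  NOT CLAIMED: anything about
maps that are not sector-preserving (they tunnel by themselves); continuous spaces; anything measured.  Literature
grade (cell rule): NEW TYPING of a known tension (flow-assisted replica exchange vs. ladder diffusion); nothing cited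
as a fact; no new bib keys.
-/

noncomputable section

open Finset Function
open Literature.Probability.MarkovChains

namespace Summit.Ventures.LatticeQCDFlow.Scaling

variable {S : Type*} [Fintype S] [DecidableEq S] {K : ℕ} {μ : Fin (K + 1) → S → ℝ}
  {M : Fin (K + 1) → S → S → ℝ} {t : ℝ} {φ : Fin K → Equiv.Perm S}

/-! ## §1 The swap difference and the swap Dirichlet form for sector-preserving maps -/

omit [Fintype S] [DecidableEq S] in
/-- A sector-preserving bijection has a sector-preserving inverse. [ours] -/
theorem mem_symm_iff {A : Finset S} {e : Equiv.Perm S} (he : ∀ u, e u ∈ A ↔ u ∈ A) (u : S) :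
    e.symm u ∈ A ↔ u ∈ A := by
  rw [← he (e.symm u), Equiv.apply_symm_apply]

/-- **The swap difference formula for sector-preserving maps:** a flow swap of levels `j, j+1` changes the profile
count by `(a_j − a_{j+1})·(1_{Aᶜ}(x_j) − 1_{Aᶜ}(x_{j+1}))` — exactly what a plain swap does. [ours] -/
theorem flowProfileCount_sub_swap (hμ1 : ∀ k, ∑ u, μ k u = 1) (a : Fin (K + 1) → ℝ) {A : Finset S}
    (hφA : ∀ j u, φ j u ∈ A ↔ u ∈ A) (x : Fin (K + 1) → S) (j : Fin K) :
    (∑ k, a k * bottleneckTestFun (μ k) A (x k)) - ∑ k, a k * bottleneckTestFun (μ k) A (flowSwapAt φ j x k)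
      = (a j.castSucc - a j.succ)
          * ((if x j.castSucc ∈ A then (0 : ℝ) else 1) - (if x j.succ ∈ A then (0 : ℝ) else 1)) := by
  have hne : j.castSucc ≠ j.succ := ne_of_lt Fin.castSucc_lt_succ
  simp_rw [bottleneckTestFun_eq (hμ1 _)]
  rw [← Finset.sum_sub_distrib]
  have hterm : ∀ k, a k * ((if x k ∈ A then (0 : ℝ) else 1) - ∑ y ∈ Aᶜ, μ k y)
      - a k * ((if flowSwapAt φ j x k ∈ A then (0 : ℝ) else 1) - ∑ y ∈ Aᶜ, μ k y)
      = a k * ((if x k ∈ A then (0 : ℝ) else 1) - (if flowSwapAt φ j x k ∈ A then (0 : ℝ) else 1)) := by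
    intro k; ring
  simp_rw [hterm]
  rw [Fintype.sum_eq_add j.castSucc j.succ hne]
  · rw [flowSwapAt_castSucc, flowSwapAt_succ, if_congr (mem_symm_iff (hφA j) (x j.succ)) rfl rfl,
      if_congr (hφA j (x j.castSucc)) rfl rfl]
    ring
  · intro k hk
    rw [flowSwapAt_of_ne φ j x hk.1 hk.2, sub_self, mul_zero]

/-- **The flow-swap move's Dirichlet form of ANY observable:**
`𝓔_π̃(ptFlowSwap μ φ; F) ≤ (2K)⁻¹·Σ_j Σ_x π̃(x)(F(x) − F(flowSwapAt φ j x))²` (acceptance at most one). [ours] -/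
theorem ptFlow_dirichletForm_swap_le (hμ : ∀ k x, 0 < μ k x) (F : (Fin (K + 1) → S) → ℝ) :
    dirichletForm (tensorFun μ) (ptFlowSwap μ φ) F
      ≤ 1 / (2 * K) * ∑ j : Fin K, ∑ x : Fin (K + 1) → S, tensorFun μ x * (F x - F (flowSwapAt φ j x)) ^ 2 := by
  have hpt : ∀ x y : Fin (K + 1) → S, tensorFun μ x * ptFlowSwap μ φ x y * (F x - F y) ^ 2
      ≤ ptFlowProposal φ x y * (tensorFun μ x * (F x - F y) ^ 2) := by
    intro x y
    by_cases hyx : y = x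
    · rw [hyx, sub_self]; simp
    · rw [← mul_assoc]
      refine mul_le_mul_of_nonneg_right ?_ (sq_nonneg _)
      rw [tensorFun_mul_ptFlowSwap hμ hyx]
      exact mul_le_mul_of_nonneg_left (min_le_left _ _) (ptFlowProposal_nonneg φ x y)
  have hrow : ∀ (x : Fin (K + 1) → S) (c : (Fin (K + 1) → S) → ℝ),
      ∑ y, ptFlowProposal φ x y * c y = ∑ j : Fin K, 1 / K * c (flowSwapAt φ j x) := by
    intro x c
    unfold ptFlowProposal
    simp_rw [Finset.sum_mul]
    rw [Finset.sum_comm]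
    refine sum_congr rfl fun j _ => ?_
    simp_rw [ite_mul, zero_mul]
    rw [Finset.sum_ite_eq' univ (flowSwapAt φ j x), if_pos (mem_univ _)]
  unfold dirichletForm
  calc 1 / 2 * ∑ x, ∑ y, tensorFun μ x * ptFlowSwap μ φ x y * (F x - F y) ^ 2
      ≤ 1 / 2 * ∑ x, ∑ y, ptFlowProposal φ x y * (tensorFun μ x * (F x - F y) ^ 2) :=
        mul_le_mul_of_nonneg_left (sum_le_sum fun x _ => sum_le_sum fun y _ => hpt x y) (by norm_num)
    _ = 1 / 2 * ∑ x, ∑ j : Fin K, 1 / K * (tensorFun μ x * (F x - F (flowSwapAt φ j x)) ^ 2) := by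
        congr 1
        exact sum_congr rfl fun x _ => hrow x (fun y => tensorFun μ x * (F x - F y) ^ 2)
    _ = 1 / (2 * K) * ∑ j : Fin K, ∑ x : Fin (K + 1) → S, tensorFun μ x * (F x - F (flowSwapAt φ j x)) ^ 2 := by
        rw [Finset.sum_comm]
        simp_rw [← Finset.mul_sum]
        rw [← mul_assoc]
        congr 1
        ring

/-- **The flow-swap Dirichlet form of the profile count, sector-preserving maps:**
`𝓔_{FSw}(G_a) ≤ (2K)⁻¹·Σ_j (a_j − a_{j+1})²·D_j(A)` — the same bound as for plain swaps. [ours] -/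
theorem ptFlow_dirichletForm_swap_profileCount_le (hμ : ∀ k x, 0 < μ k x) (hμ1 : ∀ k, ∑ u, μ k u = 1)
    (a : Fin (K + 1) → ℝ) {A : Finset S} (hφA : ∀ j u, φ j u ∈ A ↔ u ∈ A) :
    dirichletForm (tensorFun μ) (ptFlowSwap μ φ) (fun x => ∑ k, a k * bottleneckTestFun (μ k) A (x k))
      ≤ 1 / (2 * K) * ∑ j : Fin K, (a j.castSucc - a j.succ) ^ 2
          * ((∑ u ∈ A, μ j.castSucc u) * (∑ u ∈ Aᶜ, μ j.succ u)
            + (∑ u ∈ Aᶜ, μ j.castSucc u) * ∑ u ∈ A, μ j.succ u) := by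
  refine le_trans (ptFlow_dirichletForm_swap_le hμ _) (le_of_eq ?_)
  congr 1
  refine sum_congr rfl fun j _ => ?_
  rw [← levelDisagreement_eq μ hμ1 A (i := j.castSucc) (l := j.succ) (ne_of_lt Fin.castSucc_lt_succ),
    Finset.mul_sum]
  refine sum_congr rfl fun x _ => ?_
  rw [flowProfileCount_sub_swap hμ1 a hφA x j]
  ring

/-- The flow-assisted sampler's Dirichlet form splits: `𝓔_P(G) = t·𝓔_{FSw}(G) + (1−t)·𝓔_{Upd}(G)`. [ours] -/
theorem ptFlow_dirichletForm_split (t : ℝ) (μ : Fin (K + 1) → S → ℝ) (M : Fin (K + 1) → S → S → ℝ)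
    (φ : Fin K → Equiv.Perm S) (G : (Fin (K + 1) → S) → ℝ) :
    dirichletForm (tensorFun μ) (ptFlowSampler t μ M φ) G
      = t * dirichletForm (tensorFun μ) (ptFlowSwap μ φ) G
        + (1 - t) * dirichletForm (tensorFun μ) (prodKernel (fun _ : Fin (K + 1) => (1 : ℝ) / (K + 1)) M) G := by
  unfold dirichletForm
  rw [← mul_assoc, ← mul_assoc, mul_comm t, mul_comm (1 - t), mul_assoc, mul_assoc, ← mul_add]
  congr 1
  rw [Finset.mul_sum, Finset.mul_sum, ← Finset.sum_add_distrib]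
  refine sum_congr rfl fun x _ => ?_
  rw [Finset.mul_sum, Finset.mul_sum, ← Finset.sum_add_distrib]
  refine sum_congr rfl fun y _ => ?_
  rw [ptFlowSampler_apply]
  ring

/-! ## §2 The ceilings -/

/-- **THE PROFILE CEILING FOR FLOW-ASSISTED REPLICA EXCHANGE WITH SECTOR-PRESERVING MAPS:**
`Gap(ptFlowSampler t μ M φ) ≤ [t·(2K)⁻¹·Σ_j (a_j − a_{j+1})²·D_j(A) + (1−t)·(K+1)⁻¹·Σ_k a_k²·Q_k(A,Aᶜ)]
/ Σ_k a_k²·μ_k(A)μ_k(Aᶜ)` — the same as without maps (`0 ≤ t ≤ 1`, `|S| ≥ 2`). [ours] -/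
theorem ptFlow_spectralGap_le_profile [Nontrivial S] (hμ : ∀ k x, 0 < μ k x) (hμ1 : ∀ k, ∑ u, μ k u = 1)
    (hM : ∀ k, IsRowStochastic (M k)) (hMrev : ∀ k, DetailedBalance (μ k) (M k)) (ht0 : 0 ≤ t) (ht1 : t ≤ 1)
    (a : Fin (K + 1) → ℝ) {A : Finset S} (hφA : ∀ j u, φ j u ∈ A ↔ u ∈ A)
    (hA : 0 < ∑ k, a k ^ 2 * ((∑ u ∈ A, μ k u) * ∑ u ∈ Aᶜ, μ k u)) :
    spectralGap (tensorFun μ) (ptFlowSampler t μ M φ)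
      ≤ (t * (1 / (2 * K) * ∑ j : Fin K, (a j.castSucc - a j.succ) ^ 2
            * ((∑ u ∈ A, μ j.castSucc u) * (∑ u ∈ Aᶜ, μ j.succ u)
              + (∑ u ∈ Aᶜ, μ j.castSucc u) * ∑ u ∈ A, μ j.succ u))
          + (1 - t) * (1 / (K + 1) * ∑ k, a k ^ 2 * edgeMeasure (μ k) (M k) A Aᶜ))
        / ∑ k, a k ^ 2 * ((∑ u ∈ A, μ k u) * ∑ u ∈ Aᶜ, μ k u) := by
  have hP := ptFlowSampler_isRowStochastic (M := M) (φ := φ) hμ hM ht0 ht1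
  have hDB := ptFlowSampler_detailedBalance (t := t) (M := M) (φ := φ) hμ hMrev
  have hray := LevinPeres2017_lemma_13_7_rayleigh (tensorFun_pos hμ) (sum_tensorFun_eq_one μ hμ1) hP hDB
    (ptBare_mean_profileCount (μ := μ) hμ1 a A)
  rw [ptBare_piInner_profileCount hμ1 a A, ptFlow_dirichletForm_split,
    ptBare_dirichletForm_update_profileCount hμ1 hM hMrev a A] at hray
  have hsw := ptFlow_dirichletForm_swap_profileCount_le (μ := μ) hμ hμ1 a hφA
  rw [le_div_iff₀ hA]
  calc spectralGap (tensorFun μ) (ptFlowSampler t μ M φ) * ∑ k, a k ^ 2 * ((∑ u ∈ A, μ k u) * ∑ u ∈ Aᶜ, μ k u)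
      ≤ t * dirichletForm (tensorFun μ) (ptFlowSwap μ φ) (fun x => ∑ k, a k * bottleneckTestFun (μ k) A (x k))
          + (1 - t) * (1 / (K + 1) * ∑ k, a k ^ 2 * edgeMeasure (μ k) (M k) A Aᶜ) := hray
    _ ≤ _ := by
        have := mul_le_mul_of_nonneg_left hsw ht0
        linarith

/-- **THE LINEAR PROFILE, FLOW-ASSISTED:** `D_j(A) ≤ d`, `μ_k(A)μ_k(Aᶜ) ≥ v > 0` (`k ≥ 1`), `K ≥ 1`,
sector-preserving maps ⇒
`Gap(ptFlowSampler t μ M φ) ≤ 6·(t·d/2 + (1−t)·(K+1)⁻¹·Σ_k k²·Q_k(A,Aᶜ))/(v·K(K+1)(2K+1))`. [ours] -/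
theorem ptFlowLinear_spectralGap_le [Nontrivial S] (hK : 1 ≤ K) (hμ : ∀ k x, 0 < μ k x)
    (hμ1 : ∀ k, ∑ u, μ k u = 1) (hM : ∀ k, IsRowStochastic (M k)) (hMrev : ∀ k, DetailedBalance (μ k) (M k))
    (ht0 : 0 ≤ t) (ht1 : t ≤ 1) {A : Finset S} (hφA : ∀ j u, φ j u ∈ A ↔ u ∈ A) {d v : ℝ} (hvpos : 0 < v)
    (hd : ∀ j : Fin K, (∑ u ∈ A, μ j.castSucc u) * (∑ u ∈ Aᶜ, μ j.succ u)
      + (∑ u ∈ Aᶜ, μ j.castSucc u) * ∑ u ∈ A, μ j.succ u ≤ d)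
    (hv : ∀ k : Fin (K + 1), k ≠ 0 → v ≤ (∑ u ∈ A, μ k u) * ∑ u ∈ Aᶜ, μ k u) :
    spectralGap (tensorFun μ) (ptFlowSampler t μ M φ)
      ≤ 6 * (t * (d / 2) + (1 - t) * (1 / (K + 1) * ∑ k : Fin (K + 1), ((k : ℕ) : ℝ) ^ 2
          * edgeMeasure (μ k) (M k) A Aᶜ)) / (v * ((K : ℝ) * (K + 1) * (2 * K + 1))) := by
  have hKpos : (0 : ℝ) < K := Nat.cast_pos.mpr (by omega)
  have hnorm := linearProfile_norm_ge (μ := μ) A hv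
  have hS : 0 < v * ((K : ℝ) * (K + 1) * (2 * K + 1) / 6) := by positivity
  have hA : 0 < ∑ k : Fin (K + 1), ((k : ℕ) : ℝ) ^ 2 * ((∑ u ∈ A, μ k u) * ∑ u ∈ Aᶜ, μ k u) :=
    lt_of_lt_of_le hS hnorm
  have hmain := ptFlow_spectralGap_le_profile (t := t) (M := M) (φ := φ) hμ hμ1 hM hMrev ht0 ht1
    (fun k : Fin (K + 1) => ((k : ℕ) : ℝ)) hφA hA
  have hswap := linearProfile_swap_le (μ := μ) hK A hd
  have hQ : 0 ≤ (1 - t) * (1 / (K + 1) * ∑ k : Fin (K + 1), ((k : ℕ) : ℝ) ^ 2 * edgeMeasure (μ k) (M k) A Aᶜ) :=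
    mul_nonneg (by linarith) (mul_nonneg (by positivity) (sum_nonneg fun k _ => mul_nonneg (sq_nonneg _)
      (sum_nonneg fun x _ => sum_nonneg fun y _ => mul_nonneg (hμ k x).le ((hM k).1 x y))))
  have hd0 : 0 ≤ d := le_trans (add_nonneg
    (mul_nonneg (sum_nonneg fun u _ => (hμ _ u).le) (sum_nonneg fun u _ => (hμ _ u).le))
    (mul_nonneg (sum_nonneg fun u _ => (hμ _ u).le) (sum_nonneg fun u _ => (hμ _ u).le))) (hd ⟨0, hK⟩)
  have hnum : t * (1 / (2 * K) * ∑ j : Fin K, (((j.castSucc : ℕ) : ℝ) - ((j.succ : ℕ) : ℝ)) ^ 2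
          * ((∑ u ∈ A, μ j.castSucc u) * (∑ u ∈ Aᶜ, μ j.succ u)
            + (∑ u ∈ Aᶜ, μ j.castSucc u) * ∑ u ∈ A, μ j.succ u))
        + (1 - t) * (1 / (K + 1) * ∑ k : Fin (K + 1), ((k : ℕ) : ℝ) ^ 2 * edgeMeasure (μ k) (M k) A Aᶜ)
      ≤ t * (d / 2)
        + (1 - t) * (1 / (K + 1) * ∑ k : Fin (K + 1), ((k : ℕ) : ℝ) ^ 2 * edgeMeasure (μ k) (M k) A Aᶜ) := by
    have := mul_le_mul_of_nonneg_left hswap ht0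
    linarith
  have hnum0 : 0 ≤ t * (d / 2)
      + (1 - t) * (1 / (K + 1) * ∑ k : Fin (K + 1), ((k : ℕ) : ℝ) ^ 2 * edgeMeasure (μ k) (M k) A Aᶜ) :=
    add_nonneg (by positivity) hQ
  calc spectralGap (tensorFun μ) (ptFlowSampler t μ M φ)
      ≤ _ := hmain
    _ ≤ (t * (d / 2)
          + (1 - t) * (1 / (K + 1) * ∑ k : Fin (K + 1), ((k : ℕ) : ℝ) ^ 2 * edgeMeasure (μ k) (M k) A Aᶜ))
        / ∑ k : Fin (K + 1), ((k : ℕ) : ℝ) ^ 2 * ((∑ u ∈ A, μ k u) * ∑ u ∈ Aᶜ, μ k u) :=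
        div_le_div_of_nonneg_right hnum hA.le
    _ ≤ (t * (d / 2)
          + (1 - t) * (1 / (K + 1) * ∑ k : Fin (K + 1), ((k : ℕ) : ℝ) ^ 2 * edgeMeasure (μ k) (M k) A Aᶜ))
        / (v * ((K : ℝ) * (K + 1) * (2 * K + 1) / 6)) :=
        div_le_div_of_nonneg_left hnum0 hS hnorm
    _ = 6 * (t * (d / 2) + (1 - t) * (1 / (K + 1) * ∑ k : Fin (K + 1), ((k : ℕ) : ℝ) ^ 2
          * edgeMeasure (μ k) (M k) A Aᶜ)) / (v * ((K : ℝ) * (K + 1) * (2 * K + 1))) := by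
        rw [div_eq_div_iff (by positivity) (by positivity)]
        ring

/-- **SECTOR-PRESERVING FLOW SWAPS DO NOT BEAT DIFFUSION:** if no replica at a level `k ≥ 1` crosses the sector on its
own (`Q_k(A,Aᶜ) = 0`; the hot update arbitrary), `D_j(A) ≤ d`, `μ_k(A)μ_k(Aᶜ) ≥ v > 0` (`k ≥ 1`), and every map
`φ_j` preserves the sector `A`, then `Gap(ptFlowSampler t μ M φ) ≤ 3td/(v·K(K+1)(2K+1))` — for EVERY such family of
bijections, however well it transports `μ_j` to `μ_{j+1}`. [ours] -/
theorem ptFlowFrozenSector_spectralGap_le [Nontrivial S] (hK : 1 ≤ K) (hμ : ∀ k x, 0 < μ k x)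
    (hμ1 : ∀ k, ∑ u, μ k u = 1) (hM : ∀ k, IsRowStochastic (M k)) (hMrev : ∀ k, DetailedBalance (μ k) (M k))
    (ht0 : 0 ≤ t) (ht1 : t ≤ 1) {A : Finset S} (hφA : ∀ j u, φ j u ∈ A ↔ u ∈ A) {d v : ℝ} (hvpos : 0 < v)
    (hd : ∀ j : Fin K, (∑ u ∈ A, μ j.castSucc u) * (∑ u ∈ Aᶜ, μ j.succ u)
      + (∑ u ∈ Aᶜ, μ j.castSucc u) * ∑ u ∈ A, μ j.succ u ≤ d)
    (hv : ∀ k : Fin (K + 1), k ≠ 0 → v ≤ (∑ u ∈ A, μ k u) * ∑ u ∈ Aᶜ, μ k u)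
    (hfrozen : ∀ k : Fin (K + 1), k ≠ 0 → edgeMeasure (μ k) (M k) A Aᶜ = 0) :
    spectralGap (tensorFun μ) (ptFlowSampler t μ M φ) ≤ 3 * t * d / (v * ((K : ℝ) * (K + 1) * (2 * K + 1))) := by
  have h := ptFlowLinear_spectralGap_le (t := t) (M := M) (φ := φ) hK hμ hμ1 hM hMrev ht0 ht1 hφA hvpos hd hv
  have hQ0 : ∑ k : Fin (K + 1), ((k : ℕ) : ℝ) ^ 2 * edgeMeasure (μ k) (M k) A Aᶜ = 0 := by
    refine Finset.sum_eq_zero fun k _ => ?_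
    by_cases hk : k = 0
    · subst hk; simp
    · rw [hfrozen k hk, mul_zero]
  rw [hQ0, mul_zero, mul_zero, add_zero] at h
  calc spectralGap (tensorFun μ) (ptFlowSampler t μ M φ) ≤ _ := h
    _ = 3 * t * d / (v * ((K : ℝ) * (K + 1) * (2 * K + 1))) := by ring

end Summit.Ventures.LatticeQCDFlow.Scaling

end
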